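import Mathlib
import HarnessLib
import HarnessLib.Audit
import Summits.NavierStokesRegularity.Statement
import Literature.Analysis.FluidPDE.ClassicalSolution
import Literature.Analysis.FluidPDE.LerayHopf
import Literature.Analysis.FluidPDE.SuitableWeak
import Literature.Analysis.FluidPDE.SelfSimilar
import Literature.Analysis.FluidPDE.WeakSolution
import Literature.Analysis.FluidPDE.VectorCalculus
import Literature.Analysis.FluidPDE.MildSolution
import Literature.Analysis.FluidPDE.NSWave0
import Literature.Analysis.UnboundedOperators.HeatKernel
import Summits.NavierStokesRegularity.NavierStokesRegularity.Theorems.ContinuousAlignmentNoBlowupToClay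
import HarnessLib.Audit.Status.Attr

/-!
Route: OneComponentPincer

# Route OneComponentPincer — one Cartesian component in L∞tL3x forbids a Type-I singular apex

It suffices to show X = K1 ∧ K3 ∧ NoTypeII, attacking K1 (the route's own conjunct) and importing
K3, NoTypeII as declared
RESIDUALS. K1 (ONE-COMPONENT TYPE-I LIOUVILLE, deciding): every member u of the Type-I model class
𝒦_C of routes
SqueezeCycle / ClockStretchingLaw (jointly smooth divergence-free KNSS-mild ancient solutions on
ℝ³×(−∞,0), rate
|u| ≤ C/√(−t), scaled energies A, E ≤ C) ONE of whose Cartesian components u·e lies in L^∞_t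
L³_x(ℝ³×(−∞,0)) is
bounded near the apex (0,0). K3 (residual, S-implied): at a Type-I blow-up time every point has a
ball on which
some Cartesian component stays L³-bounded up to T. NoTypeII = shared
stmt-NavierStokesRegularity-0056. Supports:
TypeIZoomWithComponent (SingularZoom + one Fatou clause) and NoBlowupToClay (= stmt-0055, proved).
Realises sketch
one-component-pincer (markdown wave, readers PASS 3/4/4/4).
Lean: `OneComponentTypeILiouville ∧ OneComponentLocalCriticalBound ∧ NoTypeII`

## Assembly
Pure logic, certified in glue.lean (`closes`, sorry-free, consumes all five binders): NoBlowupToClay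
reduces Clay (A) to continuation
past every T; if a solution had no extension it is maximal, NoTypeII gives the Type-I rate,
OneComponentLocalCriticalBound gives the
local component bounds, and TypeIZoomWithComponent fed with OneComponentTypeILiouville yields the
extension — contradiction.

Rationale: WHY THIS LINE. The strongest conditional-regularity engine in print that uses the FINE structure of
the nonlinearity through a LINEAR functional
of u is the one-component theory: u₃ solves a scalar advection–diffusion equation and div u = 0
slaves ∂₃u₃ to the horizontal part,
giving ε-regularity in terms of u₃ alone at every scaling-critical (p,q) (KangNguyen2022 Thm 1.3;
WangWuZhang2020 Thm 1.2) and,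
with a Type-I rate, regularity for u₃ ∈ L^p_tL^q_x, 2/p+3/q = 1, q ∈ (3,∞] (BaeKang2019) — the
endpoint (p,q) = (∞,3) being
left open in print (WangWuZhang2020 p.3, Rem 1.2; KangNguyen2022 p.5). K1 is exactly that endpoint,
posed not for general
suitable solutions but on the compact Type-I model class 𝒦_C where the tree already owns the zoom
(singularZoom_zoomLimit),
the 𝒦_C → suitable-weak bridge (squeezeCycle_slabProfile_of_modelClass) and two Liouville corners
(AlbrittonBarker2019 Thm 1.2
= full L³; KNSS2009 planar); its first lemma FiniteApexSet (a bounded L³ component + one-component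
ε-regularity ⇒ the
final-time singular set is FINITE, by counting in a common time window) is provable now. Imported
areas: anisotropic /
one-component harmonic analysis of NS (PDE), parabolic blow-up compactness; no probabilistic or
spectral reformulation (none
touches a pointwise Type-I class). Versus the tree: TypeILiouville / ExtremalTypeIConstant want the
UNCONDITIONAL Liouville on
this class, DirectionEnergy conditions it on vorticity DIRECTION coherence, SqueezeCycle on the
middle strain eigenvalue — none
has a velocity-component object; the negatives index (stmt-1376, 4055, 1832, 1429, 0154) contains no
component statement.

RANKED CRUXES. #2 OneComponentTypeILiouville (crux) — (K1, deciding) for every C and every u in the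
Type-I model class 𝒦_C (the five clauses verbatim from SqueezeCycle.SingularZoom: jointly C^∞ on
t<0, divergence-free, KNSS/Oseen-mild, rate ‖u(t,x)‖ ≤ C/√(−t), scaled energies A,E ≤ C on all
cylinders with top time ≤ 0): if some unit e has sup_(t<0) ‖u(t)·e‖_L³(ℝ³) < ∞, then u is bounded on
some backward cylinder Q_r(0,0) (the apex is not singular). [difficulty: L] (why it might fail: the
(∞,3) endpoint is exactly where Bae–Kang/Kang–Nguyen stop (q>3 or smallness); a λ-DSS Type-I profile
U with U·e ∈ L³ but U ∉ L³ would sit in 𝒦_C with a singular apex; first-order detachment of u·e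
kills backward-uniqueness proofs.) [KangNguyen2022, BaeKang2019, WangWuZhang2020,
AlbrittonBarker2019, KNSS2009, EscauriazaSereginSverak2003]
#3 OneComponentLocalCriticalBound (crux) — (K3, DECLARED RESIDUAL, S-implied) for a finite-energy
classical solution on [0,T) from a rapidly decaying datum which is Leray–Hopf and blows up at Type-I
rate at T, every x₀ has a unit e, a radius ρ>0 and M<∞ with ‖u(t)·e‖_L³(B(x₀,ρ)) ≤ M for all t ∈
[0,T). [difficulty: open-problem] (why it might fail: as an a-priori statement it is the
one-component L^∞_tL³_x endpoint, open even as a regularity CRITERION (WangWuZhang2020 p.3); a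
Type-I singularity all of whose Cartesian components leave L³_loc contradicts nothing known.)
[WangWuZhang2020, KangNguyen2022, EscauriazaSereginSverak2003, CheminZhang2016]
#4 NoTypeII (crux) — (shared stmt-NavierStokesRegularity-0056, verbatim; DECLARED RESIDUAL here) a
maximal smooth solution with finite lifespan T which is Leray–Hopf from a rapidly decaying datum
blows up at Type-I rate ‖u(t)‖_∞ ≤ C(T−t)^(−1/2). [difficulty: open-problem] (why it might fail: No
theorem bounds a blow-up rate from above; Tao's averaged-NS blow-up is Type II (arXiv:1402.0290 p.8
fn.); KNSS2009/Seregin–Šverák 2009: an axisymmetric singularity must be Type II, so Hou's candidate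
(arXiv:2107.06509), if real, refutes it.) [Tao2016AveragedNS, arXiv:1402.0290, KNSS2009,
arXiv:2107.06509]
#9 TypeIZoomWithComponent (support) — (S1, glue, KNOWN shape) K1 (inlined verbatim as antecedent) ⇒
a finite-energy classical Leray–Hopf solution from a rapidly decaying datum with Type-I rate at T
and the local one-component bounds of K3 at every point extends smoothly past T: the zoom u_k =
(λ_k/ν) u(x₀+λ_k x, T+λ_k² t/ν) at a singular point is exactly singularZoom_zoomLimit (tree) plus
ONE Fatou clause — L³ scale invariance gives ‖u_k(t)·e‖_L³(B(0,ρ/λ_k)) ≤ M/ν and lower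
semicontinuity of eLpNorm under locally uniform convergence puts the limit's component in L^∞_tL³_x,
so K1 forbids the singular apex that persistence of singularities produces. [difficulty: M]
[AlbrittonBarker2019, KNSS2009, RusinSverak2011]
#9 NoBlowupToClay (support) — (S2 = stmt-NavierStokesRegularity-0055 verbatim, PROVED in tree by
typeICertificateLadder_noBlowupToClay_proof) continuation past every T of finite-energy classical
solutions from rapidly decaying data gives Clay (A). [difficulty: provable-now] [Leray1934,
Fefferman2000]

TWO-LAYER PLAN. Foreseen glued split of K1 once its first stub closes (registered skeleton
Lines/birth.lean): K1 ⇐ OneCompEpsReg (Kang–Nguyen (3,3) on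
𝒦_C) → FiniteApexSet (counting) → IsolatedApexLiouville (the hard core) → K1, k = 3, depth 1. K3 ⇐
regular-point bookkeeping →
Type-I singular-point core. Nothing filed now.

KILL CRITERIA. A member of 𝒦_C with one Cartesian component in L^∞_tL³_x and a singular apex (e.g. a
discretely self-similar Type-I profile U(·,s)
with U·e ∈ L³) refutes K1: close `refuted:OneComponentTypeILiouville` (the witness is banked for the
negative side as a Type-I
blow-up model). NoTypeII refuted (a Type-II singularity) is ¬Clay (A) outright and kills every
Type-I route. K3 refuted alone
(a Type-I blow-up with every component unbounded in L³_loc) leaves K1 bankable as a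
conditional-regularity theorem but retires the
route `not-a-thesis`. NoTypeIBlowup proved elsewhere (TypeILiouville, ExtremalTypeIConstant,
SqueezeCycle) moots K1 and K3.

NOT DECOMPOSED YET. The ε(C) of the one-component ε-regularity and the class-uniform pressure bound
(Albritton–Barker Lemma 2.6) — inside stub 1; the
corners of the hard core (full L³ = AlbrittonBarker2019 Thm 1.2 in tree, planar = KNSS2009 in tree,
layered/2.5-D, small component)
— layer-2 children of K1 after FiniteApexSet lands; any decomposition of the residuals K3 / NoTypeII
(owned by their own crux chains:
Cruxes/TypeIliouvilleNoTypeII has registered lines).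

CHEAPEST FALSIFIER. For K1: look for a backward discretely self-similar Type-I profile whose leading
(−1)-homogeneous far field has a vanishing Cartesian
component (then U·e ∈ L³ while U ∉ L³): the homogeneous div-free fields tangent to the planes x·e =
const exist (V = ∇⊥_h ψ, ψ
0-homogeneous), so the algebra does not forbid it — the refuter's first job is the
literature/numerics check whether any DSS
blow-up candidate (Bradshaw–Tsai-type profiles, Hou's scenario restricted to Type-I windows) has
such a tail. Run in-session: the
layered corner (u = (v_h, w)(x_h, t)) is trivial inside 𝒦_C (heat-semigroup contraction + KNSS 2-D
Liouville), so no 2.5-D witness.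

NUMBERS. One-component criteria in print: u₃ ∈ L^(q,1)_t L^p_x, 2/q+3/p ≤ 1, 3 < p < ∞
(WangWuZhang2020 Thm 1.1); smallness ε(M) at all
1 ≤ p,q ≤ ∞ (KangNguyen2022 Thm 1.3); Type I + u₃ ∈ L^pL^q, 2/p+3/q = 1, q ∈ (3,∞] (BaeKang2019);
∇u₃-criteria at 2/p+3/r = 3/2
(Lemarié-Rieusset 2016 p.354). FiniteApexSet bound: #Σ₀ < M³/ε(C)³. Items at open: 5 (3 cruxes — K1
attacked, K3 + NoTypeII residual — and 2 supports); the sketch's K2 OneComponentTypeIRate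
(one-component Type-I rate criterion, strictly below NoTypeII) is not filed: NoTypeII is wired
instead (reader's advice).

DEFINITION REQUESTS. None (𝒦_C is inlined verbatim as in SqueezeCycle; eLpNorm, inner,
IsTypeIBlowup, HasSmoothExtensionPast exist). Cite fact wanted for
stub 1 / the BC5 rung: KangNguyen2022 Thm 1.3 (one-component ε-regularity under the scaled bound
(1.6), all (p,q)) as a
Literature/Analysis/FluidPDE fact; filed as a cite workitem after open.

Novelty: Searches (2026-08-17): `lit search "Bae Kang regularity Type I one velocity component
Navier-Stokes"` (local 4: arXiv:2206.02490, 1911.02699; crossref 10 incl.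
doi:10.1016/j.aml.2019.02.024, 10.1007/s00021-022-00754-8); `lit search --hybrid "Liouville theorem
ancient Navier-Stokes solution … one velocity component u_3"` (8 books; [corpus:book:seregin2014
pp.114–121] only 2-D/axisymmetric Liouville); `lit vsearch "Type I blow-up … one component …
L-infinity in time L3"` (10 books; [corpus:book:lemarie-rieusset2016 p.354] off-scaling
one-component criteria); `lit galaxy search "one velocity component|one-component regularity|one
component of the velocity" --star all` (15 pdf hits, all engineering); `lit galaxy search "Terms of
One Velocity Component|via one velocity component|…" --star pdf` (3:
[galaxy:pdf:-3274056168053881360] Beirão da Veiga–Yang two components, slip boundary); `lit galaxy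
search "Type I singularit|ancient solutions of the Navier|Liouville theorems for the Navier" --star
pdf` (19, none one-component); `lean search` for component objects in Theses/* (none;
TypeIIInviscidRelaxation cites one-component criteria only as a layer-2 tool of its Type-II columnar
branch).
Nearest prior art found: BaeKang2019 (Type I + u₃ ∈ L^pL^q, q ∈ (3,∞]) and KangNguyen2022 Thm 1.3 /
Rem 1.1(4) (arXiv:2206.02490; smallness at all (p,q), "open question whether the smallness can be
relaxed" p.5); WangWuZhang2020 (arXiv:2005.11906, endpoint open); in tree: route TypeILiouville /
Extre  [refs: 10.1016/j.aml.2019.02.024, 10.1007/s00021-022-00754-8, 2206.02490, 2005.11906, doi:10.1016/j.aml.2019.02.024, book:seregin2014, book:lemarie-rieusset2016, BaeKang2019, KangNguyen2022, WangWuZhang2020]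

Barriers (technique_class: one-component epsilon-regularity, type-I Liouville, rescaling): - technique_class: one-component epsilon-regularity, type-I Liouville, rescaling
- Literature.Barriers.NavierStokesRegularity.AveragedTypeIBlowup: K1 sits at the blocked tier
(Type-I exclusion at the L^∞-rate) but OUTSIDE the technique class: its engine is the componentwise
structure of (u·∇)u — the scalar equation for u·e and the div-free slaving of ∂_e(u·e) — which Tao's
averaged bilinear forms B̃ do not preserve (they mix Cartesian components), the kind of "fine
structure of B" the barrier's evasions clause names; the zoom support S1 is inside the class but is
only the known conditional reduction, not the exclusion.
- Literature.Barriers.NavierStokesRegularity.TaoAveragedBlowup: same placement — nothing here treats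
B abstractly; the residual NoTypeII is conceded to require non-averaged structure (Tao's blow-up is
Type II) and no mechanism is claimed for it by this route.
- Literature.Barriers.NavierStokesRegularity.EnergySupercriticality: no supercritical a-priori
control is attempted: K1 lives on the scale-invariant class 𝒦_C (every clause dimensionless) and its
side condition is a CRITICAL norm of one component; the supercritical gap is carried openly by the
residual K3.
- Literature.Barriers.NavierStokesRegularity.NavierStokesInequalitySingularSolution: the
ε-regularity used (Kang–Nguyen) and the class 𝒦_C use the EQUATION (Oseen-mild identity, the
u₃-equation), not only the local energy inequality; Scheffer's NSI fields are not mild solutions, so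
the barrier does not q

sub-problem: NavierStokesRegularity · status: draft · opened planner-type-8cbc18b45e-0 2026-08-17T18:44:43Z · rev 0 · ledger route-NavierStokesRegularity-OneComponentPincer
GENERATED by the gate from the ledger (D-0016/17). Provers cite these decls: `theorem foo : Summit.NavierStokesRegularity.NavierStokesRegularity.Theses.OneComponentPincer.<Decl> := …` in Summits/NavierStokesRegularity/NavierStokesRegularity/Theorems/<Name>.lean.
-/

namespace Summit.NavierStokesRegularity.NavierStokesRegularity.Theses.OneComponentPincer

open scoped BigOperators Topology Manifold Classical MeasureTheory ProbabilityTheory Matrix InnerProductSpace ComplexConjugate ContinuousMap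
open Filter Set Function TopologicalSpace MeasureTheory

attribute [summit_statement] _root_.NavierStokesRegularity

open Literature.NS

/-- item stmt-NavierStokesRegularity-19556 · crux · rank 2 · open · by planner
why it might fail: the (∞,3) endpoint is exactly where Bae–Kang/Kang–Nguyen stop (q>3 or smallness); a λ-DSS Type-I profile U with U·e ∈ L³ but U ∉ L³ would sit in 𝒦_C with a singular apex; first-order detachment of u·e kills backward-uniqueness proofs.
sources: KangNguyen2022, BaeKang2019, WangWuZhang2020, AlbrittonBarker2019, KNSS2009, EscauriazaSereginSverak2003
[crux] (K1, deciding) for every C and every u in the Type-I model class 𝒦_C (the five clauses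
verbatim from SqueezeCycle.SingularZoom: jointly C^∞ on t<0, divergence-free, KNSS/Oseen-mild, rate
‖u(t,x)‖ ≤ C/√(−t), scaled energies A,E ≤ C on all cylinders with top time ≤ 0): if some unit e has
sup_(t<0) ‖u(t)·e‖_L³(ℝ³) < ∞, then u is bounded on some backward cylinder Q_r(0,0) (the apex is not
singular). [difficulty: L] -/
@[route_item "route-NavierStokesRegularity-OneComponentPincer", crux]
def OneComponentTypeILiouville : Prop :=
  ∀ (C : ℝ) (u : ℝ → EuclideanSpace ℝ (Fin 3) → EuclideanSpace ℝ (Fin 3)), ContDiffOn ℝ (⊤ : ℕ∞) (Function.uncurry u) (Set.Iio 0 ×ˢ Set.univ) ∧ (∀ t < 0, Literature.Analysis.FluidPDE.VectorCalculus.IsDivFree (u t)) ∧ (∀ s t : ℝ, s < t → t < 0 → ∀ x, u t x = Literature.Analysis.FluidPDE.heatFlow (u s) (t - s) x - ∫ τ in Set.Ioo s t, ∫ y, ((-(inner ℝ (x - y) (u τ y) / (2 * (t - τ)) * Literature.Analysis.UnboundedOperators.heatKernel (t - τ) (x - y))) • u τ y + (∫ σ in Set.Ioi (t - τ), Literature.Analysis.UnboundedOperators.heatKernel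 σ (x - y) / (4 * σ ^ 2)) • (inner ℝ (x - y) (u τ y) • u τ y + inner ℝ (u τ y) (u τ y) • (x - y) + inner ℝ (x - y) (u τ y) • u τ y) - ((∫ σ in Set.Ioi (t - τ), Literature.Analysis.UnboundedOperators.heatKernel σ (x - y) / (8 * σ ^ 3)) * (inner ℝ (x - y) (u τ y) * inner ℝ (x - y) (u τ y))) • (x - y))) ∧ Literature.Analysis.FluidPDE.HasTypeITimeDecay C u ∧ (∀ (x₀ : EuclideanSpace ℝ (Fin 3)) (t₀ r : ℝ), t₀ ≤ 0 → 0 < r → (∀ t, t₀ - r ^ 2 < t → t < t₀ → r⁻¹ * ∫ x in Metric.ball x₀ r, ‖u t x‖ ^ 2 ≤ C) ∧ r⁻¹ * ∫ t in Set.Ioo (t₀ - r ^ 2) t₀, ∫ x in Metric.ball x₀ r, ‖fderiv ℝ (u t) x‖ ^ 2 ≤ C) → (∃ e : EuclideanSpace ℝ (Fin 3), ‖e‖ = 1 ∧ ∃ M : ENNReal, M < ⊤ ∧ ∀ t < 0, MeasureTheory.eLpNorm (fun x => inner ℝ (u t x) e) 3 MeasureTheory.volume ≤ M) → ¬ (∀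 r > 0, ∀ M : ℝ, ∃ t ∈ Set.Ioo (-(r ^ 2)) (0 : ℝ), ∃ x ∈ Metric.ball (0 : EuclideanSpace ℝ (Fin 3)) r, M < ‖u t x‖)

/-- item stmt-NavierStokesRegularity-19557 · crux · rank 3 · open · by planner
why it might fail: as an a-priori statement it is the one-component L^∞_tL³_x endpoint, open even as a regularity CRITERION (WangWuZhang2020 p.3); a Type-I singularity all of whose Cartesian components leave L³_loc contradicts nothing known.
sources: WangWuZhang2020, KangNguyen2022, EscauriazaSereginSverak2003, CheminZhang2016
[crux] (K3, DECLARED RESIDUAL, S-implied) for a finite-energy classical solution on [0,T) from a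
rapidly decaying datum which is Leray–Hopf and blows up at Type-I rate at T, every x₀ has a unit e,
a radius ρ>0 and M<∞ with ‖u(t)·e‖_L³(B(x₀,ρ)) ≤ M for all t ∈ [0,T). [difficulty: open-problem] -/
@[route_item "route-NavierStokesRegularity-OneComponentPincer", crux]
def OneComponentLocalCriticalBound : Prop :=
  ∀ (ν T : ℝ), 0 < ν → 0 < T → ∀ (u : ℝ → EuclideanSpace ℝ (Fin 3) → EuclideanSpace ℝ (Fin 3)) (p : ℝ → EuclideanSpace ℝ (Fin 3) → ℝ), Literature.Analysis.FluidPDE.IsClassicalNSSolutionOn (Set.Ico 0 T) ν 0 u p → Literature.Analysis.FluidPDE.IsLerayHopfOn T ν 0 (u 0) u → Literature.Analysis.FluidPDE.HasRapidSpatialDecay (u 0) → Literature.Analysis.FluidPDE.IsTypeIBlowup u T → ∀ x₀ : EuclideanSpace ℝ (Fin 3), ∃ e : EuclideanSpace ℝ (Fin 3), ‖e‖ = 1 ∧ ∃ ρ > (0 : ℝ), ∃ M : ENNReal, M < ⊤ ∧ ∀ t ∈ Set.Ico 0 T, MeasureTheory.eLpNorm (fun x => inner ℝ (u t x) e) 3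 (MeasureTheory.volume.restrict (Metric.ball x₀ ρ)) ≤ M

/-- item stmt-NavierStokesRegularity-0056 · crux · rank 4 · open · by planner
why it might fail: No theorem bounds a blow-up rate from above; Tao's averaged-NS blow-up is Type II (arXiv:1402.0290 p.8 fn.); KNSS2009/Seregin–Šverák 2009: an axisymmetric singularity must be Type II, so Hou's candidate (arXiv:2107.06509), if real, refutes it.
sources: Tao2016AveragedNS, arXiv:1402.0290, KNSS2009, arXiv:2107.06509
If a finite-energy classical solution from a rapidly decaying datum has maximal lifespan T<∞ (no
classical extension past T), then ‖u(t)‖_∞ ≤ C (T−t)^{-1/2} eventually as t↑T (Leray's rate is the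
matching lower bound, leray_blowup_rate_top). The hardest and most informative crux: a
counterexample is a Type II singularity, i.e. ¬(Clay A). Known: lower bound c√ν (T−t)^{-1/2} (Leray
1934 §20); L³ must blow up (ESS 2003, Seregin 2012); only triple-log quantitative gain (Tao 2021). -/
@[route_item "route-NavierStokesRegularity-OneComponentPincer", crux]
def NoTypeII : Prop :=
  ∀ (ν T : ℝ), 0 < ν → 0 < T → ∀ (u : ℝ → EuclideanSpace ℝ (Fin 3) → EuclideanSpace ℝ (Fin 3)) (p : ℝ → EuclideanSpace ℝ (Fin 3) → ℝ), Literature.Analysis.FluidPDE.IsMaximalSmoothSolution ν 0 u p T → Literature.Analysis.FluidPDE.IsLerayHopfOn T ν 0 (u 0) u → Literature.Analysis.FluidPDE.HasRapidSpatialDecay (u 0) → Literature.Analysis.FluidPDE.IsTypeIBlowup u T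

/-- item stmt-NavierStokesRegularity-15607 · support · rank 9 · closed · proved by Summit.NavierStokesRegularity.NavierStokesRegularity.Theorems.continuousAlignment_noBlowupToClay_proof @ 75b41afd0230 (prover) · by planner
sources: Leray1934, Fefferman2000
[support] shared local-theory assembly (verbatim stmt-NavierStokesRegularity-0055, PROVED in tree by
Theorems.typeICertificateLadder_noBlowupToClay_proof): NoBlowup → Clay (A). [difficulty:
provable-now] -/
@[route_item "route-NavierStokesRegularity-OneComponentPincer", crux]
def NoBlowupToClay : Prop :=
  (∀ (ν T : ℝ), 0 < ν → 0 < T → ∀ (u : ℝ → EuclideanSpace ℝ (Fin 3) → EuclideanSpace ℝ (Fin 3)) (p : ℝ → EuclideanSpace ℝ (Fin 3) → ℝ), Literature.Analysis.FluidPDE.IsClassicalNSSolutionOn (Set.Ico 0 T) ν 0 u p → Literature.Analysis.FluidPDE.IsLerayHopfOn T ν 0 (u 0) u → Literature.Analysis.FluidPDE.HasRapidSpatialDecay (u 0) → Literature.Analysis.FluidPDE.HasSmoothExtensionPast ν 0 u T) → NavierStokesRegularity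

/-- `NoBlowupToClay` holds: proved by `Summit.NavierStokesRegularity.NavierStokesRegularity.Theorems.continuousAlignment_noBlowupToClay_proof` @ 75b41afd0230. -/
theorem NoBlowupToClay_holds : NoBlowupToClay := _root_.Summit.NavierStokesRegularity.NavierStokesRegularity.Theorems.continuousAlignment_noBlowupToClay_proof

/-- item stmt-NavierStokesRegularity-19558 · support · rank 9 · closed · proved by Summit.NavierStokesRegularity.NavierStokesRegularity.Theorems.oneComponentPincer_typeIZoomWithComponent_proof (prover) · by planner
sources: AlbrittonBarker2019, KNSS2009, RusinSverak2011
[support] (S1, glue, KNOWN shape) K1 (inlined verbatim as antecedent) ⇒ a finite-energy classical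
Leray–Hopf solution from a rapidly decaying datum with Type-I rate at T and the local one-component
bounds of K3 at every point extends smoothly past T: the zoom u_k = (λ_k/ν) u(x₀+λ_k x, T+λ_k² t/ν)
at a singular point is exactly singularZoom_zoomLimit (tree) plus ONE Fatou clause — L³ scale
invariance gives ‖u_k(t)·e‖_L³(B(0,ρ/λ_k)) ≤ M/ν and lower semicontinuity of eLpNorm under locally
uniform convergence puts the limit's component in L^∞_tL³_x, so K1 forbids the singular apex that
persistence of singularities produces. [difficulty: M] -/
@[route_item "route-NavierStokesRegularity-OneComponentPincer", crux]
def TypeIZoomWithComponent : Prop :=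
  (∀ (C : ℝ) (u : ℝ → EuclideanSpace ℝ (Fin 3) → EuclideanSpace ℝ (Fin 3)), ContDiffOn ℝ (⊤ : ℕ∞) (Function.uncurry u) (Set.Iio 0 ×ˢ Set.univ) ∧ (∀ t < 0, Literature.Analysis.FluidPDE.VectorCalculus.IsDivFree (u t)) ∧ (∀ s t : ℝ, s < t → t < 0 → ∀ x, u t x = Literature.Analysis.FluidPDE.heatFlow (u s) (t - s) x - ∫ τ in Set.Ioo s t, ∫ y, ((-(inner ℝ (x - y) (u τ y) / (2 * (t - τ)) * Literature.Analysis.UnboundedOperators.heatKernel (t - τ) (x - y))) • u τ y + (∫ σ in Set.Ioi (t - τ), Literature.Analysis.UnboundedOperators.heatKernel σ (x - y) / (4 * σ ^ 2)) • (inner ℝ (x - y) (u τ y) • u τ y + inner ℝ (u τ y) (u τ y) • (x - y) + inner ℝ (x - y) (u τ y) • u τ y) - ((∫ σ in Set.Ioi (t - τ), Literature.Analysis.UnboundedOperators.heatKernel σ (x - y) / (8 * σ ^ 3)) * (inner ℝ (x - y) (u τ y) * inner ℝ (x - y) (u τ y))) • (x - y))) ∧ Literature.Analysis.FluidPDE.HasTypeITimeDecay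 C u ∧ (∀ (x₀ : EuclideanSpace ℝ (Fin 3)) (t₀ r : ℝ), t₀ ≤ 0 → 0 < r → (∀ t, t₀ - r ^ 2 < t → t < t₀ → r⁻¹ * ∫ x in Metric.ball x₀ r, ‖u t x‖ ^ 2 ≤ C) ∧ r⁻¹ * ∫ t in Set.Ioo (t₀ - r ^ 2) t₀, ∫ x in Metric.ball x₀ r, ‖fderiv ℝ (u t) x‖ ^ 2 ≤ C) → (∃ e : EuclideanSpace ℝ (Fin 3), ‖e‖ = 1 ∧ ∃ M : ENNReal, M < ⊤ ∧ ∀ t < 0, MeasureTheory.eLpNorm (fun x => inner ℝ (u t x) e) 3 MeasureTheory.volume ≤ M) → ¬ (∀ r > 0, ∀ M : ℝ, ∃ t ∈ Set.Ioo (-(r ^ 2)) (0 : ℝ), ∃ x ∈ Metric.ball (0 : EuclideanSpace ℝ (Fin 3)) r, M < ‖u t x‖)) → ∀ (ν T : ℝ), 0 < ν → 0 < T → ∀ (u : ℝ → EuclideanSpace ℝ (Fin 3) → EuclideanSpace ℝ (Fin 3)) (p : ℝ → EuclideanSpace ℝ (Fin 3) → ℝ), Literature.Analysis.FluidPDE.IsClassicalNSSolutionOn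 (Set.Ico 0 T) ν 0 u p → Literature.Analysis.FluidPDE.IsLerayHopfOn T ν 0 (u 0) u → Literature.Analysis.FluidPDE.HasRapidSpatialDecay (u 0) → Literature.Analysis.FluidPDE.IsTypeIBlowup u T → (∀ x₀ : EuclideanSpace ℝ (Fin 3), ∃ e : EuclideanSpace ℝ (Fin 3), ‖e‖ = 1 ∧ ∃ ρ > (0 : ℝ), ∃ M : ENNReal, M < ⊤ ∧ ∀ t ∈ Set.Ico 0 T, MeasureTheory.eLpNorm (fun x => inner ℝ (u t x) e) 3 (MeasureTheory.volume.restrict (Metric.ball x₀ ρ)) ≤ M) → Literature.Analysis.FluidPDE.HasSmoothExtensionPast ν 0 u T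

-- `TypeIZoomWithComponent` holds: proved by `Summit.NavierStokesRegularity.NavierStokesRegularity.Theorems.oneComponentPincer_typeIZoomWithComponent_proof` (its module imports this route file, so no `_holds` link can be stated here).

/-- item stmt-NavierStokesRegularity-19559 · assembly · rank 1 · closed · proved by Summit.NavierStokesRegularity.NavierStokesRegularity.Theorems.oneComponentPincer_assembly_proof (prover) · by planner
sources: KNSS2009, AlbrittonBarker2019
[assembly] OneComponentTypeILiouville → OneComponentLocalCriticalBound → NoTypeII →
TypeIZoomWithComponent → NoBlowupToClay → NavierStokesRegularity (the implication `closes` proves;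
it consumes all five items). -/
@[route_item "route-NavierStokesRegularity-OneComponentPincer"]
def Assembly : Prop :=
  OneComponentTypeILiouville → OneComponentLocalCriticalBound → NoTypeII → TypeIZoomWithComponent → NoBlowupToClay → _root_.NavierStokesRegularity

-- `Assembly` holds: proved by `Summit.NavierStokesRegularity.NavierStokesRegularity.Theorems.oneComponentPincer_assembly_proof` (its module imports this route file, so no `_holds` link can be stated here).

/-! D-0027 §2.1 — DECIDING THEOREM (planner-authored via `route open/edit --closes-file`; by planner-type-8cbc18b45e-0 2026-08-17T18:44:43Z):
its hypotheses are this route's items and its conclusion the sub-problem Statement (glue_lint), and it elaborates with this file. -/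

@[closes "route-NavierStokesRegularity-OneComponentPincer"] theorem closes (hK1 : OneComponentTypeILiouville) (hK3 : OneComponentLocalCriticalBound) (hII : NoTypeII)
    (hZ : TypeIZoomWithComponent) (hClay : NoBlowupToClay) : _root_.NavierStokesRegularity := by
  apply hClay
  intro ν T hν hT u p hcl hLH hdec
  by_contra hext
  have hTI : Literature.Analysis.FluidPDE.IsTypeIBlowup u T := hII ν T hν hT u p ⟨hcl, hext⟩ hLH hdec
  exact hext (hZ hK1 ν T hν hT u p hcl hLH hdec hTI (hK3 ν T hν hT u p hcl hLH hdec hTI))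

end Summit.NavierStokesRegularity.NavierStokesRegularity.Theses.OneComponentPincer
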